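import Summits.KontsevichZagierPeriods.KontsevichZagierPeriods.Theorems.UnfoldedStokesStokesGenerationStubRungClampedAngularCertificate
import Summits.KontsevichZagierPeriods.KontsevichZagierPeriods.Theorems.UnfoldedStokesStokesGenerationFibrewiseRungTransport
import Literature.NumberTheory.Transcendental.SemialgebraicAlgebraicPoints

/-!
# `StokesGeneration` (stmt-KontsevichZagierPeriods-3586) — line `fibrewise_stokes`, stub `stub_saClampedAngularCertificate`

Registered rung stub X5 (rung 10, the angular sector of a semialgebraic `C¹` loop) of the line
`fibrewise_stokes` of the crux `StokesGeneration` (route UnfoldedStokes): **the clamped two-element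
half-angle certificate on a sub-interval `[a, b] ⊆ [0,1]`, with its boundary leftover, for
FUNCTIONS in place of polynomials** — the function-level transposition of the landed rung-4 stub
`stub_rungClampedAngularCertificate` (R10).

Data: real functions `U`, `W`, `U′`, `W′`, continuous on `[0,1]` and `ℚ`-semialgebraic (read on the
interval coordinate), with `U′`, `W′` the derivatives of `U`, `W` on `(0,1)`; algebraic
`0 ≤ a < b ≤ 1` and `γ`; `U > 0` on `[a,b]`, `W(a) = 0`. With the clamp `c(z) = max a (min z b)`
(continuous, onto `[a,b] ⊆ [0,1]`, the identity on `[a,b]`, kinks at `a`, `b`) put `Ũ = U ∘ c`,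
`W̃ = W ∘ c`, `Ũ′ = U′ ∘ c`, `W̃′ = W′ ∘ c` (continuous on all of `ℝ`, `Ũ > 0`) and
`χ = 1_{(a,b)}(x₀)`. The primitives on the square `[0,1]²` are `G₀ = γ Ũ W̃/(Ũ² + W̃² x₁²)`
(direction `0`, kink set `{x₀ = a} ∪ {x₀ = b}`) and
`G₁ = χ · γ x₁ (Ũ W̃′ − Ũ′ W̃)(1/(Ũ² + W̃²) − 1/(Ũ² + W̃² x₁²))` (direction `1`, no kinks), with fibre
derivatives `D₀ = χ · γ K N/E²`, `D₁ = χ · γ K (1/E₁ − N/E²)` (`K = Ũ W̃′ − Ũ′ W̃`, `E₁ = Ũ² + W̃²`,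
`E = Ũ² + W̃² x₁²`, `N = Ũ² − W̃² x₁²`; quotient rules `rungAng_hasDerivAt_dir0/dir1`). Off the kink
set the fibre `s ↦ G₀(s, x₁)` is the unclamped fibre near a point of `(a,b) ⊆ (0,1)` (where `U`, `W`
are differentiable) and is locally constant outside `[a,b]` (where `χ = 0`), whence `∂₀ G₀ = D₀`.
Boundary values: `G₀|_{x₀=1} = γ U(b) W(b)/(U(b)² + W(b)² x₁²)` (`c 1 = b`: the LEFTOVER),
`G₀|_{x₀=0} = 0` (`c 0 = a`, `W(a) = 0`), `G₁|_{x₁=0} = G₁|_{x₁=1} = 0`, and `D₀ + D₁ = χ γ K/E₁`.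
The `Dⱼ` are bounded (`|χ| ≤ 1` times a continuous function on the compact square) and
`ℚ`-semialgebraic, hence integrable. Semialgebraicity of the atoms: the clamp is `ℚ`-semialgebraic
(`rungClamp_sa_clamp`) with values in `[0,1]`, so `U ∘ c` etc. are composites of a `ℚ`-semialgebraic
function of the interval coordinate (lifted to the square) with a `[0,1]`-valued semialgebraic
function (`rungTr_isSemialgebraicFunOn_comp`, Tarski–Seidenberg); `U(b)`, `W(b)` are real-algebraic
as values of `ℚ`-semialgebraic functions at the algebraic point `b`
(`IsSemialgebraicFunOn.isAlgebraic_apply`); the rest is closure under field operations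
(Bochnak–Coste–Roy, Prop. 2.2.6).

References: J. Ayoub, *Une version relative de la conjecture des périodes de Kontsevich–Zagier*,
Ann. of Math. 181 (2015), Rem. 1.5; M. Kontsevich, D. Zagier, *Periods* (2001), §1.1–1.2;
J. Bochnak, M. Coste, M.-F. Roy, *Real Algebraic Geometry* (1998), Prop. 2.2.6.
-/

noncomputable section

-- `Summit.KontsevichZagierPeriods.KontsevichZagierPeriods.…` is the tree's mandated layout (single-conjunct summit).
set_option linter.dupNamespace false

namespace Summit.KontsevichZagierPeriods.KontsevichZagierPeriods.Cruxes.StokesGeneration.FibrewiseStokes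

open MeasureTheory Set
open Literature.NumberTheory.Transcendental
open Literature.NumberTheory.Transcendental.KZ
open Literature.ModelTheory.ExponentialFields (IsSemialgebraic)

/-- **Registered stub `stub_saClampedAngularCertificate` (rung 10, X5): the clamped two-element
half-angle certificate on a sub-interval `[a, b] ⊆ [0,1]` with its boundary leftover, for
semialgebraic `C¹` data.** For real functions `U`, `W` on `[0,1]`, continuous and `ℚ`-semialgebraic
together with their derivatives `U′`, `W′` on `(0,1)`, `U > 0` on `[a,b]`, `W(a) = 0`, algebraic
`0 ≤ a < b ≤ 1` and `γ`: with the clamp `c(z) = max a (min z b)` and `Ũ = U ∘ c`, `W̃ = W ∘ c`, the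
primitives `G₀ = γ Ũ W̃/(Ũ² + W̃² x₁²)` (direction `0`, kink set `{x₀ = a ∨ x₀ = b}`) and
`G₁ = 1_{(a,b)}(x₀) γ x₁ (Ũ W̃′ − Ũ′ W̃)(1/(Ũ² + W̃²) − 1/(Ũ² + W̃² x₁²))` (direction `1`, no kinks)
give two fibrewise Stokes elements on `[0,1]²` whose sum is
`γ·1_{(a,b)}(x₀)·(U W′ − U′ W)/(U² + W²)(x₀)` minus the leftover `γ U(b) W(b)/(U(b)² + W(b)² x₁²)`
(the boundary value `G₀|_{x₀=1}`; `G₀|_{x₀=0} = 0` as `W(a) = 0`, and `G₁|_{x₁=0} = G₁|_{x₁=1} = 0`).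
Function-level transposition of `stub_rungClampedAngularCertificate`. [cite: Ayoub2015, Rem. 1.5] -/
theorem stub_saClampedAngularCertificate :
    ∀ (γ a b : ℝ) (U W U' W' : ℝ → ℝ), IsAlgebraic ℚ γ → IsAlgebraic ℚ a → IsAlgebraic ℚ b →
      IsSemialgebraicFunOn ℚ (Set.pi Set.univ (fun _ : Fin 1 => Set.Icc (0:ℝ) 1)) (fun z => U (z 0)) → IsSemialgebraicFunOn ℚ (Set.pi Set.univ (fun _ : Fin 1 => Set.Icc (0:ℝ) 1)) (fun z => W (z 0)) →
      IsSemialgebraicFunOn ℚ (Set.pi Set.univ (fun _ : Fin 1 => Set.Icc (0:ℝ) 1)) (fun z => U' (z 0)) → IsSemialgebraicFunOn ℚ (Set.pi Set.univ (fun _ : Fin 1 => Set.Icc (0:ℝ) 1)) (fun z => W' (z 0)) →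
      ContinuousOn U (Set.Icc (0:ℝ) 1) → ContinuousOn W (Set.Icc (0:ℝ) 1) →
      ContinuousOn U' (Set.Icc (0:ℝ) 1) → ContinuousOn W' (Set.Icc (0:ℝ) 1) →
      (∀ u ∈ Set.Ioo (0:ℝ) 1, HasDerivAt U (U' u) u) → (∀ u ∈ Set.Ioo (0:ℝ) 1, HasDerivAt W (W' u) u) →
      0 ≤ a → a < b → b ≤ 1 → (∀ u ∈ Set.Icc a b, 0 < U u) → W a = 0 →
      ∃ (G D : Fin 2 → (Fin 2 → ℝ) → ℝ) (K : Fin 2 → Set (Fin 2 → ℝ)) (q : Fin 2 → IntegralRep 2),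
        (∀ j, IsSemialgebraicFunOn ℚ (Set.pi Set.univ (fun _ : Fin 2 => Set.Icc (0:ℝ) 1)) (G j) ∧
          IsSemialgebraicFunOn ℚ (Set.pi Set.univ (fun _ : Fin 2 => Set.Icc (0:ℝ) 1)) (D j) ∧
          IsSemialgebraic ℚ (K j) ∧
          (∃ B : ℝ, ∀ x ∈ (Set.pi Set.univ (fun _ : Fin 2 => Set.Icc (0:ℝ) 1)), |(G j) x| ≤ B) ∧
          (∀ x ∈ (Set.pi Set.univ (fun _ : Fin 2 => Set.Icc (0:ℝ) 1)), Set.Finite {s : ℝ | Function.update x j s ∈ (K j)}) ∧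
          (∀ x ∈ (Set.pi Set.univ (fun _ : Fin 2 => Set.Icc (0:ℝ) 1)),
            ContinuousOn (fun s : ℝ => (G j) (Function.update x j s)) (Set.Icc (0:ℝ) 1)) ∧
          (∀ x ∈ (Set.pi Set.univ (fun _ : Fin 2 => Set.Icc (0:ℝ) 1)), x ∉ (K j) → x j ∈ Set.Ioo (0:ℝ) 1 →
            HasDerivAt (fun s : ℝ => (G j) (Function.update x j s)) ((D j) x) (x j))) ∧
        (∀ j, (q j).domain = (Set.pi Set.univ (fun _ : Fin 2 => Set.Icc (0:ℝ) 1)) ∧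
          ∀ x ∈ (Set.pi Set.univ (fun _ : Fin 2 => Set.Icc (0:ℝ) 1)), (q j).integrand x =
            D j x - (G j (Function.update x j 1) - G j (Function.update x j 0))) ∧
        ∀ x ∈ (Set.pi Set.univ (fun _ : Fin 2 => Set.Icc (0:ℝ) 1)), ∑ j, (q j).integrand x =
          γ * (if a < x 0 ∧ x 0 < b then
              (U (x 0) * W' (x 0) - U' (x 0) * W (x 0)) / (U (x 0) ^ 2 + W (x 0) ^ 2)
            else 0) -
          γ * (U b * W b) / (U b ^ 2 + W b ^ 2 * x 1 ^ 2) := by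
  intro γ a b U W U' W' hγ ha hb hUsa hWsa hU'sa hW'sa hUc hWc hU'c hW'c hUd hWd ha0 hab hb1 hUpos hWa
  -- the closed square
  set S : Set (Fin 2 → ℝ) := Set.pi Set.univ (fun _ : Fin 2 => Set.Icc (0:ℝ) 1) with hS
  have hSsa : IsSemialgebraic ℚ S := by rw [hS, ← cube_eq_pi]; exact isSemialgebraic_cube
  have hSc : IsCompact S := isCompact_univ_pi fun _ => isCompact_Icc
  have hSmeas : MeasurableSet S := hSc.isClosed.measurableSet
  have h10 : (1 : Fin 2) ≠ 0 := by decide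
  have h01 : (0 : Fin 2) ≠ 1 := by decide
  -- the clamp `c z = max a (min z b)` onto `[a, b] ⊆ [0, 1]`
  have hale : a ≤ b := hab.le
  set c : ℝ → ℝ := fun s => max a (min s b) with hc
  have hcmem : ∀ s, c s ∈ Set.Icc a b := fun s =>
    ⟨le_max_left _ _, max_le hale (min_le_right _ _)⟩
  have hc01 : ∀ s, c s ∈ Set.Icc (0:ℝ) 1 := fun s => ⟨ha0.trans (hcmem s).1, (hcmem s).2.trans hb1⟩
  have hc_id : ∀ s ∈ Set.Icc a b, c s = s := fun s hs => by
    show max a (min s b) = s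
    rw [min_eq_left hs.2, max_eq_right hs.1]
  have hc_lo : ∀ s, s ≤ a → c s = a := fun s hs => by
    show max a (min s b) = a
    rw [min_eq_left (hs.trans hale), max_eq_left hs]
  have hc_hi : ∀ s, b ≤ s → c s = b := fun s hs => by
    show max a (min s b) = b
    rw [min_eq_right hs, max_eq_right hale]
  have hc1 : c 1 = b := hc_hi 1 hb1
  have hc0 : c 0 = a := hc_lo 0 ha0
  have hcc : Continuous c := continuous_const.max (continuous_id.min continuous_const)
  -- the clamped atoms `Ũ, W̃, Ũ′, W̃′` as (everywhere continuous) functions of one real variable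
  set A : ℝ → ℝ := fun s => U (c s) with hA
  set B : ℝ → ℝ := fun s => W (c s) with hB
  set A' : ℝ → ℝ := fun s => U' (c s) with hA'
  set B' : ℝ → ℝ := fun s => W' (c s) with hB'
  have hAc : Continuous A := hUc.comp_continuous hcc hc01
  have hBc : Continuous B := hWc.comp_continuous hcc hc01
  have hA'c : Continuous A' := hU'c.comp_continuous hcc hc01
  have hB'c : Continuous B' := hW'c.comp_continuous hcc hc01
  have hApos : ∀ s, 0 < A s := fun s => hUpos _ (hcmem s)
  have hE1pos : ∀ s, 0 < A s ^ 2 + B s ^ 2 := fun s =>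
    add_pos_of_pos_of_nonneg (pow_pos (hApos s) 2) (sq_nonneg _)
  have hEpos : ∀ s t : ℝ, 0 < A s ^ 2 + B s ^ 2 * t ^ 2 := fun s t =>
    add_pos_of_pos_of_nonneg (pow_pos (hApos s) 2) (mul_nonneg (sq_nonneg _) (sq_nonneg _))
  have hE1ne : ∀ x : Fin 2 → ℝ, A (x 0) ^ 2 + B (x 0) ^ 2 ≠ 0 := fun x => (hE1pos _).ne'
  have hEne : ∀ x : Fin 2 → ℝ, A (x 0) ^ 2 + B (x 0) ^ 2 * x 1 ^ 2 ≠ 0 := fun x => (hEpos _ _).ne'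
  have hE2ne : ∀ x : Fin 2 → ℝ, (A (x 0) ^ 2 + B (x 0) ^ 2 * x 1 ^ 2) ^ 2 ≠ 0 := fun x =>
    pow_ne_zero 2 (hEne x)
  -- the indicator `χ = 1_{(a,b)}(x 0)` of the open strip
  set χ : (Fin 2 → ℝ) → ℝ := fun x => if a < x 0 ∧ x 0 < b then 1 else 0 with hχ
  have hχabs : ∀ x, |χ x| ≤ 1 := fun x => by
    simp only [hχ]
    split_ifs <;> simp
  -- semialgebraic atoms on the square: the clamp is semialgebraic with values in `[0,1]`, and a
  -- semialgebraic function of the interval coordinate composed with it stays semialgebraic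
  -- (Tarski–Seidenberg, BCR Prop. 2.2.6); algebraic constants (KZ §1.1)
  have hx1sa : IsSemialgebraicFunOn ℚ S (fun x => x 1) := isSemialgebraicFunOn_apply hSsa 1
  have hγsa : IsSemialgebraicFunOn ℚ S (fun _ => γ) :=
    isSemialgebraicFunOn_const_of_isAlgebraic hSsa hγ
  have h1sa : IsSemialgebraicFunOn ℚ S (fun _ => (1:ℝ)) :=
    isSemialgebraicFunOn_const_of_isAlgebraic hSsa isAlgebraic_one
  have hcsa : IsSemialgebraicFunOn ℚ S (fun x => c (x 0)) := rungClamp_sa_clamp hSsa ha hb 0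
  have hcS : ∀ x ∈ S, c (x 0) ∈ Set.Icc (0:ℝ) 1 := fun x _ => hc01 (x 0)
  have hAsa : IsSemialgebraicFunOn ℚ S (fun x => A (x 0)) :=
    rungTr_isSemialgebraicFunOn_comp (h := U) (isSemialgebraicFunOn_sq_of_interval hUsa) hcsa hcS
  have hBsa : IsSemialgebraicFunOn ℚ S (fun x => B (x 0)) :=
    rungTr_isSemialgebraicFunOn_comp (h := W) (isSemialgebraicFunOn_sq_of_interval hWsa) hcsa hcS
  have hA'sa : IsSemialgebraicFunOn ℚ S (fun x => A' (x 0)) :=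
    rungTr_isSemialgebraicFunOn_comp (h := U') (isSemialgebraicFunOn_sq_of_interval hU'sa) hcsa hcS
  have hB'sa : IsSemialgebraicFunOn ℚ S (fun x => B' (x 0)) :=
    rungTr_isSemialgebraicFunOn_comp (h := W') (isSemialgebraicFunOn_sq_of_interval hW'sa) hcsa hcS
  have hχsa : IsSemialgebraicFunOn ℚ S χ := rungClamp_sa_indicator hSsa ha hb 0
  have hKsa : IsSemialgebraicFunOn ℚ S (fun x => A (x 0) * B' (x 0) - A' (x 0) * B (x 0)) :=
    (hAsa.fun_mul hB'sa).fun_sub (hA'sa.fun_mul hBsa)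
  have hE1sa : IsSemialgebraicFunOn ℚ S (fun x => A (x 0) ^ 2 + B (x 0) ^ 2) :=
    (hAsa.fun_pow 2).fun_add (hBsa.fun_pow 2)
  have hEsa : IsSemialgebraicFunOn ℚ S (fun x => A (x 0) ^ 2 + B (x 0) ^ 2 * x 1 ^ 2) :=
    (hAsa.fun_pow 2).fun_add ((hBsa.fun_pow 2).fun_mul (hx1sa.fun_pow 2))
  have hNsa : IsSemialgebraicFunOn ℚ S (fun x => A (x 0) ^ 2 - B (x 0) ^ 2 * x 1 ^ 2) :=
    (hAsa.fun_pow 2).fun_sub ((hBsa.fun_pow 2).fun_mul (hx1sa.fun_pow 2))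
  -- continuity atoms on the plane
  have hx1c : Continuous fun x : Fin 2 → ℝ => x 1 := continuous_apply 1
  have hAS : Continuous fun x : Fin 2 → ℝ => A (x 0) := hAc.comp (continuous_apply 0)
  have hBS : Continuous fun x : Fin 2 → ℝ => B (x 0) := hBc.comp (continuous_apply 0)
  have hA'S : Continuous fun x : Fin 2 → ℝ => A' (x 0) := hA'c.comp (continuous_apply 0)
  have hB'S : Continuous fun x : Fin 2 → ℝ => B' (x 0) := hB'c.comp (continuous_apply 0)
  have hKS : Continuous fun x : Fin 2 → ℝ => A (x 0) * B' (x 0) - A' (x 0) * B (x 0) :=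
    (hAS.mul hB'S).sub (hA'S.mul hBS)
  have hE1S : Continuous fun x : Fin 2 → ℝ => A (x 0) ^ 2 + B (x 0) ^ 2 :=
    (hAS.pow 2).add (hBS.pow 2)
  have hES : Continuous fun x : Fin 2 → ℝ => A (x 0) ^ 2 + B (x 0) ^ 2 * x 1 ^ 2 :=
    (hAS.pow 2).add ((hBS.pow 2).mul (hx1c.pow 2))
  have hNS : Continuous fun x : Fin 2 → ℝ => A (x 0) ^ 2 - B (x 0) ^ 2 * x 1 ^ 2 :=
    (hAS.pow 2).sub ((hBS.pow 2).mul (hx1c.pow 2))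
  -- the witnesses (R9's formulas on the clamped atoms, directions `1` and the `D`'s cut by `χ`)
  set G0 : (Fin 2 → ℝ) → ℝ := fun x =>
    γ * (A (x 0) * B (x 0)) / (A (x 0) ^ 2 + B (x 0) ^ 2 * x 1 ^ 2) with hG0
  set D0 : (Fin 2 → ℝ) → ℝ := fun x => χ x *
    (γ * ((A (x 0) * B' (x 0) - A' (x 0) * B (x 0)) * (A (x 0) ^ 2 - B (x 0) ^ 2 * x 1 ^ 2)) /
      (A (x 0) ^ 2 + B (x 0) ^ 2 * x 1 ^ 2) ^ 2) with hD0
  set G1 : (Fin 2 → ℝ) → ℝ := fun x => χ x *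
    (γ * x 1 * (A (x 0) * B' (x 0) - A' (x 0) * B (x 0)) *
      (1 / (A (x 0) ^ 2 + B (x 0) ^ 2) - 1 / (A (x 0) ^ 2 + B (x 0) ^ 2 * x 1 ^ 2))) with hG1
  set D1 : (Fin 2 → ℝ) → ℝ := fun x => χ x *
    (γ * (A (x 0) * B' (x 0) - A' (x 0) * B (x 0)) *
      (1 / (A (x 0) ^ 2 + B (x 0) ^ 2) -
        (A (x 0) ^ 2 - B (x 0) ^ 2 * x 1 ^ 2) / (A (x 0) ^ 2 + B (x 0) ^ 2 * x 1 ^ 2) ^ 2)) with hD1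
  -- the leftover `G₀|_{x₀ = 1}`
  set L : (Fin 2 → ℝ) → ℝ := fun x =>
    γ * (U b * W b) / (U b ^ 2 + W b ^ 2 * x 1 ^ 2) with hL
  -- semialgebraicity (closure under field operations, BCR Prop. 2.2.6)
  have hG0sa : IsSemialgebraicFunOn ℚ S G0 :=
    (hγsa.fun_mul (hAsa.fun_mul hBsa)).div hEsa fun x _ => hEne x
  have hD0sa : IsSemialgebraicFunOn ℚ S D0 :=
    hχsa.fun_mul ((hγsa.fun_mul (hKsa.fun_mul hNsa)).div (hEsa.fun_pow 2) fun x _ => hE2ne x)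
  have hG1sa : IsSemialgebraicFunOn ℚ S G1 :=
    hχsa.fun_mul (((hγsa.fun_mul hx1sa).fun_mul hKsa).fun_mul
      ((h1sa.div hE1sa fun x _ => hE1ne x).fun_sub (h1sa.div hEsa fun x _ => hEne x)))
  have hD1sa : IsSemialgebraicFunOn ℚ S D1 :=
    hχsa.fun_mul ((hγsa.fun_mul hKsa).fun_mul
      ((h1sa.div hE1sa fun x _ => hE1ne x).fun_sub
        (hNsa.div (hEsa.fun_pow 2) fun x _ => hE2ne x)))
  have hUbpos : 0 < U b := hUpos b ⟨hale, le_rfl⟩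
  have hLpos : ∀ x : Fin 2 → ℝ, 0 < U b ^ 2 + W b ^ 2 * x 1 ^ 2 := fun x =>
    add_pos_of_pos_of_nonneg (pow_pos hUbpos 2) (mul_nonneg (sq_nonneg _) (sq_nonneg _))
  -- `U b`, `W b` are algebraic: values of `ℚ`-semialgebraic functions at the algebraic point `b`
  have hbI : (fun _ : Fin 1 => b) ∈ Set.pi Set.univ (fun _ : Fin 1 => Set.Icc (0:ℝ) 1) :=
    Set.mem_univ_pi.mpr fun _ => ⟨ha0.trans hale, hb1⟩
  have hUbsa : IsSemialgebraicFunOn ℚ S (fun _ => U b) :=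
    isSemialgebraicFunOn_const_of_isAlgebraic hSsa (hUsa.isAlgebraic_apply hbI fun _ => hb)
  have hWbsa : IsSemialgebraicFunOn ℚ S (fun _ => W b) :=
    isSemialgebraicFunOn_const_of_isAlgebraic hSsa (hWsa.isAlgebraic_apply hbI fun _ => hb)
  have hLsa : IsSemialgebraicFunOn ℚ S L :=
    (hγsa.fun_mul (hUbsa.fun_mul hWbsa)).div
      ((hUbsa.fun_pow 2).fun_add ((hWbsa.fun_pow 2).fun_mul (hx1sa.fun_pow 2)))
      fun x _ => (hLpos x).ne'
  -- continuity of `G₀`, `L` and of the continuous factors of `D₀`, `G₁`, `D₁`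
  have hG0c : Continuous G0 := (continuous_const.mul (hAS.mul hBS)).div₀ hES hEne
  have hD0cc : Continuous fun x : Fin 2 → ℝ =>
      γ * ((A (x 0) * B' (x 0) - A' (x 0) * B (x 0)) * (A (x 0) ^ 2 - B (x 0) ^ 2 * x 1 ^ 2)) /
        (A (x 0) ^ 2 + B (x 0) ^ 2 * x 1 ^ 2) ^ 2 :=
    (continuous_const.mul (hKS.mul hNS)).div₀ (hES.pow 2) hE2ne
  have hG1cc : Continuous fun x : Fin 2 → ℝ =>
      γ * x 1 * (A (x 0) * B' (x 0) - A' (x 0) * B (x 0)) *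
        (1 / (A (x 0) ^ 2 + B (x 0) ^ 2) - 1 / (A (x 0) ^ 2 + B (x 0) ^ 2 * x 1 ^ 2)) :=
    ((continuous_const.mul hx1c).mul hKS).mul
      ((continuous_const.div₀ hE1S hE1ne).sub (continuous_const.div₀ hES hEne))
  have hD1cc : Continuous fun x : Fin 2 → ℝ =>
      γ * (A (x 0) * B' (x 0) - A' (x 0) * B (x 0)) *
        (1 / (A (x 0) ^ 2 + B (x 0) ^ 2) -
          (A (x 0) ^ 2 - B (x 0) ^ 2 * x 1 ^ 2) / (A (x 0) ^ 2 + B (x 0) ^ 2 * x 1 ^ 2) ^ 2) :=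
    (continuous_const.mul hKS).mul
      ((continuous_const.div₀ hE1S hE1ne).sub (hNS.div₀ (hES.pow 2) hE2ne))
  have hLc : Continuous L :=
    continuous_const.div₀ (continuous_const.add (continuous_const.mul (hx1c.pow 2)))
      fun x => (hLpos x).ne'
  -- bounds on the compact square (`|χ| ≤ 1` times a continuous function)
  have hbd : ∀ (F f : (Fin 2 → ℝ) → ℝ), Continuous f → (∀ x, F x = χ x * f x) →
      ∃ M : ℝ, ∀ x ∈ S, |F x| ≤ M := by
    intro F f hf hF
    obtain ⟨M, hM⟩ := hSc.exists_bound_of_continuousOn hf.continuousOn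
    refine ⟨M, fun x hx => ?_⟩
    rw [hF, abs_mul]
    exact (mul_le_of_le_one_left (abs_nonneg _) (hχabs x)).trans
      (by simpa only [Real.norm_eq_abs] using hM x hx)
  have hG0bd : ∃ M : ℝ, ∀ x ∈ S, |G0 x| ≤ M := by
    obtain ⟨M, hM⟩ := hSc.exists_bound_of_continuousOn hG0c.continuousOn
    exact ⟨M, fun x hx => by simpa only [Real.norm_eq_abs] using hM x hx⟩
  have hD0bd : ∃ M : ℝ, ∀ x ∈ S, |D0 x| ≤ M := hbd D0 _ hD0cc fun x => rfl
  have hG1bd : ∃ M : ℝ, ∀ x ∈ S, |G1 x| ≤ M := hbd G1 _ hG1cc fun x => rfl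
  have hD1bd : ∃ M : ℝ, ∀ x ∈ S, |D1 x| ≤ M := hbd D1 _ hD1cc fun x => rfl
  -- integrability of bounded semialgebraic functions on the square
  have hint : ∀ F : (Fin 2 → ℝ) → ℝ, IsSemialgebraicFunOn ℚ S F → (∃ M : ℝ, ∀ x ∈ S, |F x| ≤ M) →
      IntegrableOn F S := by
    rintro F hF ⟨M, hM⟩
    exact IntegrableOn.of_bound hSc.measure_lt_top
      (aestronglyMeasurable_of_isSemialgebraicFunOn hF hSmeas) M
      (ae_restrict_of_forall_mem hSmeas fun x hx => by rw [Real.norm_eq_abs]; exact hM x hx)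
  -- boundary values
  have hG0_one : ∀ x, G0 (Function.update x 0 1) = L x := fun x => by
    simp only [hG0, hL, hA, hB, Function.update_self, Function.update_of_ne h10, hc1]
  have hG0_zero : ∀ x, G0 (Function.update x 0 0) = 0 := fun x => by
    simp only [hG0, hA, hB, Function.update_self, hc0, hWa, mul_zero, zero_div]
  have hG1_one : ∀ x, G1 (Function.update x 1 1) = 0 := fun x => by
    simp only [hG1, Function.update_self, Function.update_of_ne h01]
    ring
  have hG1_zero : ∀ x, G1 (Function.update x 1 0) = 0 := fun x => by
    simp only [hG1, Function.update_self]
    ring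
  -- packaged as `Fin 2`-families
  set G : Fin 2 → (Fin 2 → ℝ) → ℝ := ![G0, G1] with hG
  set D : Fin 2 → (Fin 2 → ℝ) → ℝ := ![D0, D1] with hD
  set K : Fin 2 → Set (Fin 2 → ℝ) := ![{x | x 0 = a} ∪ {x | x 0 = b}, ∅] with hK
  set I : Fin 2 → (Fin 2 → ℝ) → ℝ := ![fun x => D0 x - L x, D1] with hI
  have hGsa : ∀ j, IsSemialgebraicFunOn ℚ S (G j) := Fin.forall_fin_two.2 ⟨hG0sa, hG1sa⟩
  have hDsa : ∀ j, IsSemialgebraicFunOn ℚ S (D j) := Fin.forall_fin_two.2 ⟨hD0sa, hD1sa⟩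
  have hKsa' : ∀ j, IsSemialgebraic ℚ (K j) :=
    Fin.forall_fin_two.2 ⟨(isSemialgebraic_setOf_apply_eq_of_isAlgebraic ha 0).union
      (isSemialgebraic_setOf_apply_eq_of_isAlgebraic hb 0),
      Literature.ModelTheory.ExponentialFields.isSemialgebraic_empty⟩
  have hGbd : ∀ j, ∃ M : ℝ, ∀ x ∈ S, |G j x| ≤ M := Fin.forall_fin_two.2 ⟨hG0bd, hG1bd⟩
  have hIsa : ∀ j, IsSemialgebraicFunOn ℚ S (I j) :=
    Fin.forall_fin_two.2 ⟨hD0sa.fun_sub hLsa, hD1sa⟩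
  have hIint : ∀ j, IntegrableOn (I j) S :=
    Fin.forall_fin_two.2 ⟨(hint D0 hD0sa hD0bd).sub (hLc.continuousOn.integrableOn_compact hSc),
      hint D1 hD1sa hD1bd⟩
  -- the fibre functions
  have hG0fun : ∀ x : Fin 2 → ℝ, (fun s : ℝ => G 0 (Function.update x 0 s)) =
      fun s => γ * (A s * B s) / (A s ^ 2 + B s ^ 2 * x 1 ^ 2) := fun x => by
    funext s
    simp only [hG, hG0, Matrix.cons_val_zero, Function.update_self, Function.update_of_ne h10]
  have hG1fun : ∀ x : Fin 2 → ℝ, (fun s : ℝ => G 1 (Function.update x 1 s)) =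
      fun s => χ x * (γ * s * (A (x 0) * B' (x 0) - A' (x 0) * B (x 0)) *
        (1 / (A (x 0) ^ 2 + B (x 0) ^ 2) - 1 / (A (x 0) ^ 2 + B (x 0) ^ 2 * s ^ 2))) := fun x => by
    funext s
    simp only [hG, hG1, hχ, Matrix.cons_val_one, Matrix.cons_val_fin_one, Function.update_self,
      Function.update_of_ne h01]
  -- finiteness of the kink fibres
  have hKfin : ∀ j, ∀ x ∈ S, Set.Finite {s : ℝ | Function.update x j s ∈ K j} := by
    refine Fin.forall_fin_two.2 ⟨fun x _ => ?_, fun x _ => ?_⟩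
    · refine ((Set.finite_singleton b).insert a).subset ?_
      intro s hs
      simp only [hK, Matrix.cons_val_zero, mem_setOf_eq, mem_union, Function.update_self] at hs
      simpa only [Set.mem_insert_iff, Set.mem_singleton_iff] using hs
    · simp [hK]
  -- continuity along closed fibres
  have hGfib : ∀ j, ∀ x ∈ S,
      ContinuousOn (fun s : ℝ => G j (Function.update x j s)) (Set.Icc (0:ℝ) 1) := by
    refine Fin.forall_fin_two.2 ⟨fun x _ => ?_, fun x _ => ?_⟩
    · rw [hG0fun x]
      exact ((continuous_const.mul (hAc.mul hBc)).div₀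
        ((hAc.pow 2).add ((hBc.pow 2).mul continuous_const)) fun s => (hEpos s (x 1)).ne').continuousOn
    · rw [hG1fun x]
      exact (continuous_const.mul ((((continuous_const.mul continuous_id).mul continuous_const).mul
        ((continuous_const.div₀ continuous_const fun _ => hE1ne x).sub
          (continuous_const.div₀ (continuous_const.add (continuous_const.mul (continuous_pow 2)))
            fun s => (hEpos (x 0) s).ne'))))).continuousOn
  -- derivatives along open fibres, off the kink set
  have hGder : ∀ j, ∀ x ∈ S, x ∉ K j → x j ∈ Set.Ioo (0:ℝ) 1 →
      HasDerivAt (fun s : ℝ => G j (Function.update x j s)) (D j x) (x j) := by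
    refine Fin.forall_fin_two.2 ⟨fun x _ hxK _ => ?_, fun x _ _ _ => ?_⟩
    · have hxK' : ¬x 0 = a ∧ ¬x 0 = b := by
        simpa only [hK, Matrix.cons_val_zero, mem_union, mem_setOf_eq, not_or] using hxK
      rw [hG0fun x]
      rcases lt_or_gt_of_ne hxK'.1 with hlt | hgt
      · -- left of `a`: the fibre is locally constant, `χ = 0`
        have hn : ¬(a < x 0 ∧ x 0 < b) := fun h => lt_asymm hlt h.1
        have hDx : D 0 x = 0 := by
          simp only [hD, hD0, Matrix.cons_val_zero, hχ, if_neg hn, zero_mul]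
        rw [hDx]
        refine (hasDerivAt_const (x 0) (γ * (A a * B a) / (A a ^ 2 + B a ^ 2 * x 1 ^ 2))).congr_of_eventuallyEq ?_
        filter_upwards [Iio_mem_nhds hlt] with s hs
        simp only [hA, hB, hc_lo s (le_of_lt hs), hc_lo a le_rfl]
      · rcases lt_or_gt_of_ne hxK'.2 with hlt' | hgt'
        · -- inside `(a, b) ⊆ (0, 1)`: the clamp is the identity near `x 0`, R9's quotient rule
          have hin : a < x 0 ∧ x 0 < b := ⟨hgt, hlt'⟩
          have hxI : x 0 ∈ Set.Ioo (0:ℝ) 1 := ⟨ha0.trans_lt hgt, hlt'.trans_le hb1⟩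
          have hcx : c (x 0) = x 0 := hc_id _ ⟨hgt.le, hlt'.le⟩
          have hDx : D 0 x = γ * ((U (x 0) * W' (x 0) - U' (x 0) * W (x 0)) *
                (U (x 0) ^ 2 - W (x 0) ^ 2 * x 1 ^ 2)) /
              (U (x 0) ^ 2 + W (x 0) ^ 2 * x 1 ^ 2) ^ 2 := by
            simp only [hD, hD0, Matrix.cons_val_zero, hχ, if_pos hin, one_mul, hA, hB, hA', hB', hcx]
          have hE : U (x 0) ^ 2 + W (x 0) ^ 2 * x 1 ^ 2 ≠ 0 := by
            have h := hEne x
            simp only [hA, hB, hcx] at h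
            exact h
          rw [hDx]
          refine (rungAng_hasDerivAt_dir0 (γ := γ) (hUd _ hxI) (hWd _ hxI) hE).congr_of_eventuallyEq ?_
          filter_upwards [Ioo_mem_nhds hgt hlt'] with s hs
          simp only [hA, hB, hc_id s ⟨hs.1.le, hs.2.le⟩]
        · -- right of `b`: locally constant again
          have hn : ¬(a < x 0 ∧ x 0 < b) := fun h => lt_asymm hgt' h.2
          have hDx : D 0 x = 0 := by
            simp only [hD, hD0, Matrix.cons_val_zero, hχ, if_neg hn, zero_mul]
          rw [hDx]
          refine (hasDerivAt_const (x 0) (γ * (A b * B b) / (A b ^ 2 + B b ^ 2 * x 1 ^ 2))).congr_of_eventuallyEq ?_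
          filter_upwards [Ioi_mem_nhds hgt'] with s hs
          simp only [hA, hB, hc_hi s (le_of_lt hs), hc_hi b le_rfl]
    · have hDx : D 1 x = χ x * (γ * (A (x 0) * B' (x 0) - A' (x 0) * B (x 0)) *
          (1 / (A (x 0) ^ 2 + B (x 0) ^ 2) -
            (A (x 0) ^ 2 - B (x 0) ^ 2 * x 1 ^ 2) / (A (x 0) ^ 2 + B (x 0) ^ 2 * x 1 ^ 2) ^ 2)) := by
        simp only [hD, hD1, Matrix.cons_val_one, Matrix.cons_val_fin_one]
      rw [hG1fun x, hDx]
      exact (rungAng_hasDerivAt_dir1 (hEne x)).const_mul (χ x)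
  -- the two closed-square representations
  let q : Fin 2 → IntegralRep 2 := fun j =>
    { domain := S
      integrand := I j
      isSemialgebraic_domain := hSsa
      isSemialgebraicFunOn_integrand := hIsa j
      integrableOn := hIint j }
  refine ⟨G, D, K, q, fun j => ⟨hGsa j, hDsa j, hKsa' j, hGbd j, hKfin j, hGfib j, hGder j⟩,
    ?_, fun x _ => ?_⟩
  · -- the integrand clauses
    refine Fin.forall_fin_two.2 ⟨⟨rfl, fun x _ => ?_⟩, ⟨rfl, fun x _ => ?_⟩⟩
    · show D0 x - L x = D0 x - (G0 (Function.update x 0 1) - G0 (Function.update x 0 0))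
      rw [hG0_one, hG0_zero, sub_zero]
    · show D1 x = D1 x - (G1 (Function.update x 1 1) - G1 (Function.update x 1 0))
      rw [hG1_one, hG1_zero, sub_zero, sub_zero]
  · -- the identity `Σ_j (q j).integrand = γ · 1_{(a,b)} · (U W′ − U′ W)/(U² + W²) − leftover`
    rw [Fin.sum_univ_two]
    have hsum : (q 0).integrand x + (q 1).integrand x = (D0 x - L x) + D1 x := rfl
    rw [hsum]
    by_cases hin : a < x 0 ∧ x 0 < b
    · have hcx : c (x 0) = x 0 := hc_id _ ⟨hin.1.le, hin.2.le⟩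
      rw [if_pos hin]
      simp only [hD0, hD1, hL, hχ, if_pos hin, one_mul, hA, hB, hA', hB', hcx]
      ring
    · rw [if_neg hin]
      simp only [hD0, hD1, hL, hχ, if_neg hin, zero_mul]
      ring

end Summit.KontsevichZagierPeriods.KontsevichZagierPeriods.Cruxes.StokesGeneration.FibrewiseStokes
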